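import Mathlib
import Literature.NumberTheory.LFunctions.DeBruijnHDiv
import Literature.NumberTheory.LFunctions.DeBruijnNewmanConstProofs
import Literature.Analysis.Complex.DeBruijnUniversalFactorsProofs
import Literature.Analysis.Complex.JensenCircles

/-!
# RiemannHypothesis / UniversalFactor — `MixedFactorReduction`, route-file-independent

Route `RiemannHypothesis/UniversalFactor`, item **`MixedFactorReduction`** (stmt-RiemannHypothesis-14035,
formerly stmt-RiemannHypothesis-2580): real-rootedness propagates UP the divisibility order of de
Bruijn's universal factors — for `t ≥ 0`, a multiset `s` of rates and `a ∈ s`, if the transform of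
`e^{−tu²} Φ(u)/∏_{b∈s}(1 + u²/b²)` has only real zeros then so has the Laplace-smoothed
`F_a = deBruijnHDiv (fun u ↦ 1 + u²/a²)` (`Φ = deBruijnPhi`, `deBruijnHDiv m z = ∫₀^∞ Φ/m · cos(z·)`).

The item is PROVED in the tree by `UniversalFactor.mixedFactorReduction`
(`UniversalFactorMixedFactorReduction.lean`), but that module imports the route file
`Summits.RiemannHypothesis.RiemannHypothesis.Theses.UniversalFactor`, and the gate links a closed item
as `import <proving module>` + `theorem MixedFactorReduction_holds` INTO the route file — an import
cycle (route revs 3/5). This module imports neither the route file nor any module importing it, and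
its single theorem `UniversalFactorStandalone.mixedFactorReduction` states the BODY of the route decl
verbatim, so the item can be closed `--by` it (the device of `UniversalFactorStandalone.wideKernelNoGo`
and `UniversalFactorStandalone.laguerreLift`; `example : UniversalFactor.MixedFactorReduction :=
UniversalFactorStandalone.mixedFactorReduction` elaborates by unfolding, checked 2026-08-16). To avoid
a second public copy of the lemmas of `UniversalFactorMixedFactorReduction.lean` and
`UniversalFactorLaguerreLift.lean`, the ingredients are kept LOCAL to the proof; for continuous `m ≥ 1`:
(1) the even kernel `Φ(|s|)/m(|s|)` is de Bruijn-admissible with trigonometric integral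
`2 · deBruijnHDiv m`, so `deBruijnHDiv m` is real entire of order `< 2` (de Bruijn 1950, Thm. 10), and
`deBruijnHDiv m 0 > 0`; (2) Laguerre's step, Hadamard-free: for `f` real entire of order `< 2` with
only real zeros and real `c`, `f' + c f` is `≡ 0` or has only real zeros (`im_mul_im_logDeriv_le`,
`im_logDeriv_eq_zero_of_forall_ne_zero` of `LaguerrePolya.lean`); (3) the ODE
`(1 − D²/b²) deBruijnHDiv (m·(1 + u²/b²)) = deBruijnHDiv m`, whence the Laguerre step up the order
(two steps `D ± b`); (4) the Gaussian step up the order (de Bruijn 1950, Thm. 13 with `Δ = 0`: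
`DeBruijn1950.rootsInStrip_zero_gaussian`, `λ = √(2t)`); (5) Gaussian step, then one Laguerre step per
element of `s ∖ {a}` (multiset induction). The positivity of the rates is not needed (`b` enters
through `b²`; `b = 0` gives the factor `1` by `x/0 = 0`).

References: N. G. de Bruijn, Duke Math. J. 17 (1950), Thms. 10, 13; E. Laguerre, Œuvres I,
pp. 167–180; D. A. Cardon, Proc. AMS 130 (2002), §3 Q. 7.
-/

noncomputable section

namespace Summit.RiemannHypothesis.RiemannHypothesis.Theorems

open MeasureTheory Set Filter
open Literature.NumberTheory.LFunctions Literature.Analysis.Complex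

/-- **`MixedFactorReduction`** (the body of the route decl, verbatim; item stmt-RiemannHypothesis-14035):
for `t ≥ 0`, a multiset `s` of rates and `a ∈ s`, if the transform of
`e^{−tu²} Φ(u) / ∏_{b∈s} (1 + u²/b²)` has only real zeros, then so has the Laplace-smoothed
`F_a = deBruijnHDiv (fun u ↦ 1 + u²/a²)`. The hypothesis is `HasOnlyRealZeros (deBruijnHDiv (P_s · e^{tu²}))`
with `P_s(u) = ∏_{b∈s}(1 + u²/b²) ≥ 1` continuous; the Gaussian step (de Bruijn Thm. 13) removes
`e^{tu²}`, and writing `s = a ::ₘ r`, one Hadamard-free Laguerre step `(1 − D²/b²)` per element of `r`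
removes the factors `1 + u²/b²`, `b ∈ r`. Same mathematics as `UniversalFactor.mixedFactorReduction`
(`UniversalFactorMixedFactorReduction.lean`), restated in a module that does not import the route file.
[folklore] -/
theorem UniversalFactorStandalone.mixedFactorReduction :
    ∀ (t a : ℝ) (s : Multiset ℝ), 0 ≤ t → a ∈ s → (∀ b ∈ s, 0 < b) →
      Literature.NumberTheory.LFunctions.HasOnlyRealZeros (fun z : ℂ => ∫ u in Set.Ioi (0:ℝ),
        ((Real.exp (-(t * u ^ 2)) * Literature.NumberTheory.LFunctions.deBruijnPhi u /
          (s.map fun b => 1 + u ^ 2 / b ^ 2).prod : ℝ) : ℂ) * Complex.cos (z * u)) →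
      Literature.NumberTheory.LFunctions.HasOnlyRealZeros
        (Literature.NumberTheory.LFunctions.deBruijnHDiv (fun u : ℝ => 1 + u ^ 2 / a ^ 2)) := by
  /- (1) Continuous multipliers `m ≥ 1`: admissibility, the de Bruijn kernel `Φ(|s|)/m(|s|)`,
  growth of order `< 2`, and `deBruijnHDiv m 0 ≠ 0`. -/
  have hadm : ∀ m : ℝ → ℝ, Continuous m → (∀ u, 1 ≤ m u) → IsDivAdmissible m := by
    intro m hmc hm1
    refine ⟨hmc.aestronglyMeasurable, 1, 0, zero_le_one, fun u _ ↦ ?_⟩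
    rw [abs_of_pos (by linarith [hm1 u]), zero_mul, Real.exp_zero, mul_one]
    exact inv_le_one_of_one_le₀ (hm1 u)
  have hK : ∀ m : ℝ → ℝ, Continuous m → (∀ u, 1 ≤ m u) →
      DeBruijn1950.IsAdmissible (fun s : ℝ ↦ ((Newman.evenPhi s / m |s| : ℝ) : ℂ)) := by
    intro m hmc hm1
    have hle : ∀ s : ℝ, ‖(((Newman.evenPhi s / m |s| : ℝ) : ℂ))‖ ≤ ‖deBruijnKernel 0 s‖ := by
      intro s
      have hm_pos : 0 < m |s| := by linarith [hm1 |s|]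
      rw [norm_deBruijnKernel, zero_mul, Real.exp_zero, one_mul, Complex.norm_real,
        Real.norm_eq_abs, abs_of_nonneg (div_nonneg (Newman.evenPhi_nonneg s) hm_pos.le)]
      exact div_le_self (Newman.evenPhi_nonneg s) (hm1 _)
    have hcont : Continuous fun s : ℝ ↦ ((Newman.evenPhi s / m |s| : ℝ) : ℂ) :=
      Complex.continuous_ofReal.comp (Newman.continuous_evenPhi.div (hmc.comp continuous_abs)
        fun s ↦ (by linarith [hm1 |s|] : (0 : ℝ) < m |s|).ne')
    obtain ⟨C, hC, hCle⟩ := exists_norm_deBruijnKernel_le 0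
    refine ⟨?_, fun s ↦ ?_, ⟨3, C, by norm_num, Eventually.of_forall fun s ↦ ?_⟩⟩
    · exact (integrable_deBruijnKernel 0).norm.mono' hcont.aestronglyMeasurable
        (Eventually.of_forall hle)
    · simp only [Newman.evenPhi_neg, abs_neg, Complex.conj_ofReal]
    · have h1 : Real.exp (-|s|) ≤ 1 := Real.exp_le_one_iff.2 (neg_nonpos.2 (abs_nonneg s))
      calc ‖(((Newman.evenPhi s / m |s| : ℝ) : ℂ))‖ ≤ ‖deBruijnKernel 0 s‖ := hle s
        _ ≤ C * Real.exp (-|s|) * Real.exp (-|s| ^ 3) := hCle s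
        _ ≤ C * 1 * Real.exp (-|s| ^ 3) :=
            mul_le_mul_of_nonneg_right (mul_le_mul_of_nonneg_left h1 hC) (Real.exp_pos _).le
        _ = C * Real.exp (-|s| ^ (3 : ℝ)) := by
            rw [mul_one, show (3 : ℝ) = ((3 : ℕ) : ℝ) by norm_num, Real.rpow_natCast]
  have hfold : ∀ m : ℝ → ℝ, Continuous m → (∀ u, 1 ≤ m u) → ∀ z : ℂ,
      trigIntegral (fun s : ℝ ↦ ((Newman.evenPhi s / m |s| : ℝ) : ℂ)) z = 2 * deBruijnHDiv m z := by
    intro m hmc hm1 z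
    have hF := hK m hmc hm1
    set k : ℝ → ℂ := fun s ↦ ((Newman.evenPhi s / m |s| : ℝ) : ℂ) *
      Complex.exp (Complex.I * z * s) with hk
    have hki : Integrable k :=
      integrable_mul_cexp_of_exp_moment hF.integrable.aestronglyMeasurable z
        (hF.integrable_norm_mul_exp ‖z‖)
    have h1 : trigIntegral (fun s : ℝ ↦ ((Newman.evenPhi s / m |s| : ℝ) : ℂ)) z =
        (∫ s in Iic (0 : ℝ), k s) + ∫ s in Ioi (0 : ℝ), k s := by
      rw [trigIntegral, intervalIntegral.integral_Iic_add_Ioi hki.integrableOn hki.integrableOn]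
    have h2 : ∫ s in Iic (0 : ℝ), k s = ∫ s in Ioi (0 : ℝ), k (-s) := by
      rw [integral_comp_neg_Ioi, neg_zero]
    rw [h1, h2, ← integral_add hki.comp_neg.integrableOn hki.integrableOn, deBruijnHDiv,
      ← integral_const_mul]
    refine setIntegral_congr_fun measurableSet_Ioi fun s (hs : 0 < s) ↦ ?_
    have hcos : Complex.exp (Complex.I * z * ((-s : ℝ) : ℂ)) + Complex.exp (Complex.I * z * s) =
        2 * Complex.cos (z * s) := by
      rw [Complex.two_cos]; push_cast; ring_nf
    simp only [hk]
    rw [Newman.evenPhi_neg, abs_neg, ← mul_add, hcos, Newman.evenPhi_of_nonneg hs.le, abs_of_pos hs]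
    push_cast
    ring
  have hgrowth : ∀ m : ℝ → ℝ, Continuous m → (∀ u, 1 ≤ m u) →
      ∃ ρ C : ℝ, 0 ≤ ρ ∧ ρ < 2 ∧ ∀ z, ‖deBruijnHDiv m z‖ ≤ C * Real.exp (‖z‖ ^ ρ) := by
    intro m hmc hm1
    obtain ⟨ρ, C₀, hρ0, hρ, h⟩ := (hK m hmc hm1).exists_order_bound
    refine ⟨ρ, C₀ / 2, hρ0, hρ, fun z ↦ ?_⟩
    have h1 := h z
    rw [hfold m hmc hm1, norm_mul, Complex.norm_two] at h1
    linarith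
  have hne0 : ∀ m : ℝ → ℝ, Continuous m → (∀ u, 1 ≤ m u) → deBruijnHDiv m 0 ≠ 0 := by
    intro m hmc hm1
    have hm_pos : ∀ u, 0 < m u := fun u ↦ by linarith [hm1 u]
    have hpos : ∀ u ∈ Ioi (0 : ℝ), 0 < deBruijnPhi u / m u := fun u hu ↦
      div_pos (deBruijnPhi_pos_of_nonneg (le_of_lt hu)) (hm_pos u)
    have hintR : IntegrableOn (fun u : ℝ ↦ deBruijnPhi u / m u) (Ioi 0) := by
      refine (integrableOn_deBruijnHBound 0 0).mono' ?_ ?_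
      · exact ((continuousOn_deBruijnPhi_Ici.mono Ioi_subset_Ici_self).div hmc.continuousOn
          fun u _ ↦ (hm_pos u).ne').aestronglyMeasurable measurableSet_Ioi
      · refine ae_restrict_of_forall_mem measurableSet_Ioi fun u _ ↦ ?_
        rw [Real.norm_eq_abs, deBruijnHBound, zero_mul, Real.exp_zero, one_mul, zero_mul,
          Real.exp_zero, mul_one, abs_div, abs_of_pos (hm_pos u)]
        exact div_le_self (abs_nonneg _) (hm1 u)
    have heq : deBruijnHDiv m 0 = ((∫ u in Ioi (0 : ℝ), deBruijnPhi u / m u : ℝ) : ℂ) := by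
      rw [deBruijnHDiv, ← integral_complex_ofReal]
      exact setIntegral_congr_fun measurableSet_Ioi fun u _ ↦ by simp
    rw [heq, Complex.ofReal_ne_zero]
    apply ne_of_gt
    have hsupp : Function.support (fun u : ℝ ↦ deBruijnPhi u / m u) ∩ Ioi 0 = Ioi 0 :=
      inter_eq_right.2 fun u hu ↦ (hpos u hu).ne'
    rw [setIntegral_pos_iff_support_of_nonneg_ae
      (ae_restrict_of_forall_mem measurableSet_Ioi fun u hu ↦ (hpos u hu).le) hintR,
      hsupp, Real.volume_Ioi]
    exact ENNReal.zero_lt_top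
  /- (2) A real-valued entire function is constant; Laguerre's step, Hadamard-free. -/
  have hconst : ∀ g : ℂ → ℂ, Differentiable ℂ g → (∀ z, (g z).im = 0) → ∀ z w, g z = g w := by
    intro g hg him z w
    have hga : AnalyticOnNhd ℂ g univ := hg.differentiableOn.analyticOnNhd isOpen_univ
    rcases hga.is_constant_or_isOpenMap with ⟨c, hc⟩ | hopen
    · rw [hc z, hc w]
    · exfalso
      have hU : IsOpen (g '' univ) := by simpa using hopen univ isOpen_univ
      obtain ⟨δ, hδ, hball⟩ := Metric.isOpen_iff.1 hU (g 0) ⟨0, mem_univ _, rfl⟩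
      have hmem : g 0 + Complex.I * (δ / 2 : ℝ) ∈ Metric.ball (g 0) δ := by
        rw [Metric.mem_ball, dist_eq_norm]
        have : ‖Complex.I * ((δ / 2 : ℝ) : ℂ)‖ = δ / 2 := by
          rw [norm_mul, Complex.norm_I, one_mul, Complex.norm_real, Real.norm_eq_abs,
            abs_of_pos (by positivity)]
        simp only [add_sub_cancel_left, this]
        linarith
      obtain ⟨u, -, hu⟩ := hball hmem
      have := him u
      rw [hu] at this
      simp [him 0] at this
      exact hδ.ne' this
  have hstep : ∀ (f : ℂ → ℂ) (ρ C c : ℝ), Differentiable ℂ f → 0 ≤ ρ → ρ < 2 →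
      (∀ z, ‖f z‖ ≤ C * Real.exp (‖z‖ ^ ρ)) → (∀ x : ℝ, (f x).im = 0) →
      (∀ z, f z = 0 → z.im = 0) →
      (∀ z, deriv f z + c * f z = 0) ∨ (∀ z, deriv f z + c * f z = 0 → z.im = 0) := by
    intro f ρ C c hf hρ0 hρ hgr hreal hzero
    by_cases hex : ∃ a, f a = 0
    · obtain ⟨a, ha⟩ := hex
      refine Or.inr fun z hz ↦ ?_
      by_contra hzim
      have hfz : f z ≠ 0 := fun h ↦ hzim (hzero z h)
      have hq : deriv f z / f z = -(c : ℂ) := by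
        rw [div_eq_iff hfz]; linear_combination hz
      have him : (deriv f z / f z).im = 0 := by rw [hq]; simp
      have key := im_mul_im_logDeriv_le hf hρ0 hρ hgr hreal hzero hzim ha
      rw [him, mul_zero] at key
      have hza : z - a ≠ 0 := by
        intro h
        apply hzim
        rw [sub_eq_zero.1 h]
        exact hzero a ha
      have h1 : 0 < z.im ^ 2 := by positivity
      have h2 : 0 < ‖z - a‖ ^ 2 := by positivity
      have hpos : 0 < z.im ^ 2 / ‖z - a‖ ^ 2 := div_pos h1 h2
      linarith
    · push Not at hex
      set g : ℂ → ℂ := fun z ↦ deriv f z / f z + c with hg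
      have hgd : Differentiable ℂ g := fun z ↦ ((hf.deriv z).div (hf z) (hex z)).add_const _
      have him : ∀ z, (g z).im = 0 := fun z ↦ by
        simp only [hg, Complex.add_im, Complex.ofReal_im, add_zero]
        exact im_logDeriv_eq_zero_of_forall_ne_zero hf hρ0 hρ hgr hreal hex z
      have hfg : ∀ z, deriv f z + c * f z = f z * g z := fun z ↦ by
        simp only [hg]
        field_simp [hex z]
      by_cases hg0 : ∃ w, g w = 0
      · obtain ⟨w, hw⟩ := hg0
        refine Or.inl fun z ↦ ?_
        rw [hfg, hconst g hgd him z w, hw, mul_zero]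
      · push Not at hg0
        refine Or.inr fun z hz ↦ ?_
        rw [hfg] at hz
        rcases mul_eq_zero.1 hz with h | h
        · exact absurd h (hex z)
        · exact absurd h (hg0 z)
  /- (3) The ODE `(1 − D²/b²) deBruijnHDiv (m·(1 + u²/b²)) = deBruijnHDiv m`. -/
  have hODE : ∀ m : ℝ → ℝ, IsDivAdmissible m → ∀ (b : ℝ) (z : ℂ),
      deBruijnHDiv (fun u : ℝ => m u * (1 + u ^ 2 / b ^ 2)) z -
          deriv (deriv (deBruijnHDiv fun u : ℝ => m u * (1 + u ^ 2 / b ^ 2))) z / b ^ 2 =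
        deBruijnHDiv m z := by
    intro m hm b z
    set m' : ℝ → ℝ := fun u ↦ m u * (1 + u ^ 2 / b ^ 2) with hm'_def
    have hm' : IsDivAdmissible m' := hm.mul (isDivAdmissible_laplace b)
    have hl_pos : ∀ u : ℝ, 0 < 1 + u ^ 2 / b ^ 2 := fun u ↦ by positivity
    rw [hm'.deriv_deriv_deBruijnHDiv, ← divCosMoment_zero, ← divCosMoment_zero]
    simp only [neg_div, sub_neg_eq_add]
    rw [divCosMoment, divCosMoment, divCosMoment, ← integral_div,
      ← integral_add (hm'.integrableOn_divCosIntegrand 0 z)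
      ((hm'.integrableOn_divCosIntegrand 2 z).div_const _)]
    refine setIntegral_congr_fun measurableSet_Ioi fun u _ ↦ ?_
    have key : divWeight m' 0 u + divWeight m' 2 u / b ^ 2 = divWeight m 0 u := by
      simp only [divWeight, pow_zero, one_mul, hm'_def]
      have hL := (hl_pos u).ne'
      calc deBruijnPhi u / (m u * (1 + u ^ 2 / b ^ 2)) +
            u ^ 2 * (deBruijnPhi u / (m u * (1 + u ^ 2 / b ^ 2))) / b ^ 2
          = deBruijnPhi u / (m u * (1 + u ^ 2 / b ^ 2)) * (1 + u ^ 2 / b ^ 2) := by ring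
        _ = deBruijnPhi u / m u := by rw [div_mul_eq_mul_div, mul_div_mul_right _ _ hL]
    simp only [divCosIntegrand]
    rw [← key]
    push_cast
    ring
  /- (4) The Laguerre step up the universal-factor order. -/
  have hlap : ∀ m : ℝ → ℝ, Continuous m → (∀ u, 1 ≤ m u) → ∀ b : ℝ,
      HasOnlyRealZeros (deBruijnHDiv fun u : ℝ => m u * (1 + u ^ 2 / b ^ 2)) →
      HasOnlyRealZeros (deBruijnHDiv m) := by
    intro m hmc hm1 b h
    rcases eq_or_ne b 0 with rfl | hb
    · have : (fun u : ℝ => m u * (1 + u ^ 2 / (0 : ℝ) ^ 2)) = m := funext fun u ↦ by simp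
      rwa [this] at h
    set m' : ℝ → ℝ := fun u ↦ m u * (1 + u ^ 2 / b ^ 2) with hm'
    have hm'c : Continuous m' := hmc.mul (by fun_prop)
    have hm'1 : ∀ u, 1 ≤ m' u := fun u ↦ by
      have h0 : 0 ≤ u ^ 2 / b ^ 2 := by positivity
      exact one_le_mul_of_one_le_of_one_le (hm1 u) (by linarith)
    set F : ℂ → ℂ := deBruijnHDiv m' with hFdef
    have hzero : ∀ z, F z = 0 → z.im = 0 := h
    have hFd : Differentiable ℂ F := (hadm m' hm'c hm'1).differentiable_deBruijnHDiv
    have hFreal : ∀ x : ℝ, (F x).im = 0 := fun x ↦ deBruijnHDiv_ofReal_im m' x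
    obtain ⟨ρ, C, hρ0, hρ, hgr⟩ := hgrowth m' hm'c hm'1
    -- the intermediate function `G = F' + bF`
    set G : ℂ → ℂ := fun z ↦ deriv F z + (b : ℂ) * F z with hGdef
    have hFd' : Differentiable ℂ (deriv F) := hFd.deriv
    have hGd : Differentiable ℂ G := hFd'.add (hFd.const_mul _)
    have hderivG : ∀ z, deriv G z = deriv (deriv F) z + (b : ℂ) * deriv F z := fun z ↦
      (((hFd' z).hasDerivAt).add (((hFd z).hasDerivAt).const_mul (b : ℂ))).deriv
    have hODE' : ∀ z, F z - deriv (deriv F) z / (b : ℂ) ^ 2 = deBruijnHDiv m z := fun z ↦ by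
      have := hODE m (hadm m hmc hm1) b z
      exact_mod_cast this
    have hb0 : (b : ℂ) ≠ 0 := by exact_mod_cast hb
    have hH : ∀ z, deBruijnHDiv m z = -(deriv G z + (-(b : ℝ) : ℝ) * G z) / (b : ℂ) ^ 2 := by
      intro z
      rw [← hODE' z, hderivG]
      simp only [hGdef]
      push_cast
      field_simp
      ring
    have hz₁ : deBruijnHDiv m 0 ≠ 0 := hne0 m hmc hm1
    have hGreal : ∀ x : ℝ, (G x).im = 0 := fun x ↦ by
      simp only [hGdef, Complex.add_im, Complex.mul_im, Complex.ofReal_re, Complex.ofReal_im,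
        zero_mul, add_zero, im_deriv_ofReal hFd hFreal x, hFreal x, mul_zero]
    -- growth of `G`: exponent `(ρ + 2)/2`
    obtain ⟨C₁, h₁⟩ := norm_deriv_le_of_growth hFd hρ0 hρ hgr
    obtain ⟨K, -, hK⟩ := exists_add_rpow_le ρ 0 hρ0 hρ le_rfl
    have hC : 0 ≤ C := growthConst_nonneg hgr
    have hgr' : ∀ z, ‖G z‖ ≤ (C₁ + |b| * (C * Real.exp K)) * Real.exp (‖z‖ ^ ((ρ + 2) / 2)) := by
      intro z
      have h2 : ‖(b : ℂ) * F z‖ ≤ |b| * (C * Real.exp K) * Real.exp (‖z‖ ^ ((ρ + 2) / 2)) := by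
        rw [norm_mul, Complex.norm_real, Real.norm_eq_abs, mul_assoc, mul_assoc, ← Real.exp_add]
        refine mul_le_mul_of_nonneg_left ((hgr z).trans
          (mul_le_mul_of_nonneg_left (Real.exp_le_exp.2 ?_) hC)) (abs_nonneg b)
        simpa using hK ‖z‖ (norm_nonneg z)
      calc ‖G z‖ ≤ ‖deriv F z‖ + ‖(b : ℂ) * F z‖ := norm_add_le _ _
        _ ≤ C₁ * Real.exp (‖z‖ ^ ((ρ + 2) / 2)) +
            |b| * (C * Real.exp K) * Real.exp (‖z‖ ^ ((ρ + 2) / 2)) := add_le_add (h₁ z) h2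
        _ = (C₁ + |b| * (C * Real.exp K)) * Real.exp (‖z‖ ^ ((ρ + 2) / 2)) := by ring
    rcases hstep F ρ C b hFd hρ0 hρ hgr hFreal hzero with hG0 | hGz
    · -- `G ≡ 0` would give `deBruijnHDiv m ≡ 0`
      exfalso
      apply hz₁
      have hG0' : G = 0 := funext hG0
      rw [hH, hG0']
      simp
    · rcases hstep G ((ρ + 2) / 2) _ (-b) hGd (by positivity) (by linarith) hgr' hGreal hGz
        with hK0 | hKz
      · exfalso
        apply hz₁
        rw [hH, hK0]
        simp
      · intro z hz
        refine hKz z ?_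
        have h := hH z
        rw [hz] at h
        exact neg_eq_zero.1 ((div_eq_zero_iff.1 h.symm).resolve_right (pow_ne_zero 2 hb0))
  /- (5) The Gaussian step up the order (de Bruijn 1950, Thm. 13 with `Δ = 0`, `λ = √(2t)`). -/
  have hgauss : ∀ m : ℝ → ℝ, Continuous m → (∀ u, 1 ≤ m u) → ∀ t : ℝ, 0 ≤ t →
      HasOnlyRealZeros (deBruijnHDiv fun u : ℝ => m u * Real.exp (t * u ^ 2)) →
      HasOnlyRealZeros (deBruijnHDiv m) := by
    intro m hmc hm1 t ht h
    set m' : ℝ → ℝ := fun u ↦ m u * Real.exp (t * u ^ 2) with hm'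
    have hm'c : Continuous m' := hmc.mul (by fun_prop)
    have hm'1 : ∀ u, 1 ≤ m' u := fun u ↦
      one_le_mul_of_one_le_of_one_le (hm1 u) (Real.one_le_exp (by positivity))
    have hroots : RootsInStrip (trigIntegral fun s : ℝ ↦ ((Newman.evenPhi s / m' |s| : ℝ) : ℂ)) 0 := by
      rw [rootsInStrip_zero_iff]
      intro z hz
      rw [hfold m' hm'c hm'1] at hz
      exact h z ((mul_eq_zero.1 hz).resolve_left two_ne_zero)
    have hkey : (fun s : ℝ ↦ ((Newman.evenPhi s / m' |s| : ℝ) : ℂ) *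
        (Real.exp (Real.sqrt (2 * t) ^ 2 * s ^ 2 / 2) : ℝ)) =
        fun s : ℝ ↦ ((Newman.evenPhi s / m |s| : ℝ) : ℂ) := by
      funext s
      rw [Real.sq_sqrt (by positivity), ← Complex.ofReal_mul]
      congr 1
      simp only [hm', sq_abs]
      rw [show 2 * t * s ^ 2 / 2 = t * s ^ 2 by ring]
      have hexp := Real.exp_pos (t * s ^ 2)
      have hms : m |s| ≠ 0 := by linarith [hm1 |s|]
      field_simp
    have hne : ∃ z, trigIntegral (fun s : ℝ ↦ ((Newman.evenPhi s / m' |s| : ℝ) : ℂ) *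
        (Real.exp (Real.sqrt (2 * t) ^ 2 * s ^ 2 / 2) : ℝ)) z ≠ 0 := by
      refine ⟨0, ?_⟩
      rw [hkey, hfold m hmc hm1]
      exact mul_ne_zero two_ne_zero (hne0 m hmc hm1)
    have hres := DeBruijn1950.rootsInStrip_zero_gaussian (hK m' hm'c hm'1) (Real.sqrt (2 * t)) hroots hne
    rw [hkey, rootsInStrip_zero_iff] at hres
    intro z hz
    apply hres z
    rw [hfold m hmc hm1, hz, mul_zero]
  /- (6) The reduction to the Laplace ray. -/
  intro t a s ht ha _ hG
  set P : Multiset ℝ → ℝ → ℝ := fun r u ↦ (r.map fun b => 1 + u ^ 2 / b ^ 2).prod with hP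
  have hPc : ∀ r, Continuous (P r) := fun r ↦
    continuous_multiset_prod (f := fun b u : ℝ => 1 + u ^ 2 / b ^ 2) r fun b _ ↦ by fun_prop
  have hP1 : ∀ r u, 1 ≤ P r u := fun r u ↦ Multiset.one_le_prod fun x hx ↦ by
    obtain ⟨b, -, rfl⟩ := Multiset.mem_map.1 hx
    have : 0 ≤ u ^ 2 / b ^ 2 := by positivity
    linarith
  -- the hypothesis says that `deBruijnHDiv (P s · e^{tu²})` has only real zeros
  have hG' : HasOnlyRealZeros (deBruijnHDiv fun u : ℝ => P s u * Real.exp (t * u ^ 2)) := by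
    have heq : (deBruijnHDiv fun u : ℝ => P s u * Real.exp (t * u ^ 2)) = fun z : ℂ =>
        ∫ u in Set.Ioi (0:ℝ), ((Real.exp (-(t * u ^ 2)) * deBruijnPhi u /
          (s.map fun b => 1 + u ^ 2 / b ^ 2).prod : ℝ) : ℂ) * Complex.cos (z * u) := by
      funext z
      rw [deBruijnHDiv]
      refine setIntegral_congr_fun measurableSet_Ioi fun u _ ↦ ?_
      have hPs : (s.map fun b => 1 + u ^ 2 / b ^ 2).prod ≠ 0 := by
        have h1 := hP1 s u; simp only [hP] at h1; linarith
      have hexp := Real.exp_pos (t * u ^ 2)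
      congr 2
      simp only [hP]
      rw [Real.exp_neg]
      field_simp
    rw [heq]
    exact hG
  -- Gaussian step (Thm. 13), then one Laguerre step per element of `s ∖ {a}`
  have hKs : HasOnlyRealZeros (deBruijnHDiv (P s)) := hgauss (P s) (hPc s) (hP1 s) t ht hG'
  obtain ⟨r, rfl⟩ : ∃ r, s = a ::ₘ r := ⟨s.erase a, (Multiset.cons_erase ha).symm⟩
  suffices key : ∀ r : Multiset ℝ, HasOnlyRealZeros (deBruijnHDiv (P (a ::ₘ r))) →
      HasOnlyRealZeros (deBruijnHDiv fun u : ℝ => 1 + u ^ 2 / a ^ 2) from key r hKs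
  intro r
  induction r using Multiset.induction_on with
  | empty =>
    intro h
    have e : P (a ::ₘ 0) = fun u : ℝ => 1 + u ^ 2 / a ^ 2 := by
      funext u; simp [hP]
    rwa [e] at h
  | cons b r ih =>
    intro h
    apply ih
    have e : P (a ::ₘ b ::ₘ r) = fun u ↦ P (a ::ₘ r) u * (1 + u ^ 2 / b ^ 2) := by
      funext u
      simp only [hP, Multiset.map_cons, Multiset.prod_cons]
      ring
    rw [e] at h
    exact hlap _ (hPc _) (hP1 _) b h

end Summit.RiemannHypothesis.RiemannHypothesis.Theorems
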